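import Summits.QuantumFields.BalabanUV.Beta.RemainderExplicitHistoryDiagonalSource

/-!
# RemainderExplicitHistoryDiagonalCriterion — ROAD P3, STATION S-d4p3-g48-1, FOURTH AND CLOSING FILE: THE CUTOFF DISCREPANCY OF THE
# CONTINUUM COUPLING OBEYS A TWO-SIDED LAW `astar g m − invSq g m 0 ≍ m^{−3∕2}·Σ_a ρ(a)·min(a,m)²` for every pinned family of runs of the
# order-0 profile family — hence it is bounded UNIFORMLY in the infrared distance `m` IFF `Σ_a ρ(a)·min(a,m)² = O(m^{3∕2})`: a HALF moment
# `Σ_a ρ(a)√a < ∞` suffices, a first moment gives decay `O(m^{−1∕2})`, and generation 47's conjecture «iff `Σ_a aρ(a) < ∞`» is corrected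

Cell `pub-balaban`, β-function sub-cell, BINDER row D4 «RemainderConst leaves for Bałaban's split» (`HOME/BINDER-OWNERS.md`; owner
lineage `b2b-balaban-beta-an4`; this file by co-owner #3 lineage `b2b-balaban-beta-d4-p3`, road P3 «the reduction road», generation 48,
station S-d4p3-g48-1 «the cutoff discrepancy of the continuum coupling: two-sided law», fourth and closing file; imports the station's third
file `RemainderExplicitHistoryDiagonalSource` (hence the whole station and the ninth file of S-d4p3-g47-1)), β-FLOW TEAM duty (1);
FREEZE (0) honoured (def-free module in road P3's own `RemainderExplicit*` series; no leaf, no interface, no Literature file).  SOURCE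
OF THE SHAPES ONLY: [Balaban1987RG1] (0.20) p. 256, (0.31) and Thm 2 p. 259, §5 p. 298.  Pure real analysis.

HONEST FRAMING (page 1 of everything the β sub-cell writes).  *"Discharging BetaPertH makes Bałaban's UV stability UNCONDITIONAL —
a real constructive-QFT result; it is NOT the continuum limit and NOT the Clay problem."*  THIS FILE DISCHARGES NOTHING OF THE
KIND.  It is [folklore] real analysis about ONE explicit toy family (ours), road P3's ORDER-0 PROFILE FAMILY
`β_{k+1} = b + Σ_{i≤k} ρ(k−i)·min(g_k, |g_k − g_i|)` (generation 44), whose memory PROFILE `ρ ≥ 0` is merely summable (`Σ_{a<N} ρ_a ≤ W`).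
Nothing of Bałaban's (1.22) is asserted or constructed; row D4 class UNCHANGED (critical-path width 0; instance 0∕1; D4 DISCHARGE NO
DATE); NOT B12 Thm 2, NOT BetaPertH, NOT continuum, NOT Clay.  HONEST DEPENDENCY: continuum YM on T⁴ ⇐ BetaPertH ∧ nine spine
estimates (0/9 proved); BetaPertH ⇐ (D1) ∧ (D4) ∧ CAP+tail; G-an2-4 gates asym, D1 and NE2/3/4.  ABSOLUTE RULE: nothing is cited as a
fact.  All letters NOT-IN-PRINT; `BetaFlowAsPrinted S` records a Markov β_n only ⇒ no junction of the as-printed interface changes.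

THE STATION'S QUESTION (generation 47's census, `RemainderExplicitHistoryDiagonalMonotone.hasSum_disc`): for a pinned family of runs the
diagonal discrepancy series has sum `Q(m) := astar g m − invSq g m 0` (continuum recursion variable `m` scales above the pin MINUS the
ultraviolet end of the run with exactly `m` steps); WHEN is `sup_m Q(m) < ∞`?  Generation 47 conjectured «iff `Σ_a a·ρ(a) < ∞`» from numerics.
THE STATION'S ANSWER: `Q(m) ≍ m^{−3∕2}·Σ_a ρ(a)·min(a,m)²` (two-sided — the lower side for the running maximum `max_{m′≤m} Q(m′)` —
with constants in `b, γ, W, g_IR`; the upper side under `Wγ < b`), so `sup_m Q(m) < ∞` iff `Σ_a ρ(a)·min(a,m)² = O(m^{3∕2})`; a bounded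
HALF moment `Σ_a ρ(a)√a` suffices (the first moment is not needed and even gives decay `O(m^{−1∕2})`); for `ρ(a) ≍ a^{−p}` the criterion
reads `p ≥ 3∕2` (kernel text: the borderline `p = 3∕2` and a sparse violating profile in the annex `…DiagonalExamples`, `p > 3∕2` through
the half moment) — the conjectured first-moment threshold `p > 2` is not the true one.

WHAT IS PROVED HERE ([folklore]; 0 sorry; 0 `def`; a family `K ↦ g K` of runs of the family in ]0,γ] pinned at one `g_IR`; `κ = (b+Wγ)∕b`,
`q = 1 − Wγ∕b`, `b₂ = 1∕g_IR² + b + Wγ`, `κ₂ = b₂∕b`).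
* §1 FAMILY FORMS of the second file's sandwich: **`invSq_sub_le_src`** (`0 ≤ invSq g m n − invSq g m 0 ≤ src(n,m)∕q`), **`astar_sub_invSq_le`**
  (a cutoff-uniform source bound `S` gives `0 ≤ astar g m − invSq g m 0 ≤ S∕q`), **`src_le_of_astar_sub_invSq_le`** (NO smallness: a bound `C`
  on `astar g m′ − invSq g m′ 0`, `m′ ≤ m`, gives `src(n,m) ≤ (1 + Wγ∕b)·C` for every cutoff `n`).
* §2 ENDs: `min_sq_le`; **`astar_sub_invSq_le_minSq`** (UPPER LAW: `Σ_{a<N} ρ(a)min(a,m)² ≤ Ψ` for all `N` ⟹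
  `astar g m − invSq g m 0 ≤ 8κΨ∕(q·m√(bm))`); **`astar_sub_invSq_le_of_moments`** (half moment ⟹ `≤ 8κM∕(q√b)` UNIFORMLY; first moment ⟹
  `≤ 8κM₁∕(q√b√m)`; second moment ⟹ `≤ 8κM₂∕(q·m√(bm))`); **`minSq_le_of_astar_sub_invSq_le`** (LOWER LAW, no smallness:
  `(1∕(8κ₂m√(b₂m)))·Σ_{a<N} ρ(a)min(a,m)² ≤ (1 + Wγ∕b)·max_{m′≤m}(astar g m′ − invSq g m′ 0)`); **`uniform_iff_minSq`** (THE CRITERION: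
  `(∃ C, ∀ m, astar g m − invSq g m 0 ≤ C) ↔ (∃ C′, ∀ m ≥ 1, ∀ N, Σ_{a<N} ρ(a)min(a,m)² ≤ C′·m√m)`).
READING (sense (α)): along road P3's order-0 family the continuum coupling forgets its cutoff at the rate at which the memory profile's
`min(a,m)²`-moment grows slower than `m^{3∕2}`; the geometric shapes (NE4 as typed) are one extreme, the half-moment the honest threshold.
-/

noncomputable section

open Finset Filter Topology

namespace Summit.QuantumFields.BalabanUV.Beta.RemainderExplicitHistoryDiagonalCriterion

open Literature.MathematicalPhysics.QuantumFieldTheory.Balaban1983to89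
open Literature.MathematicalPhysics.QuantumFieldTheory.Balaban1983to89.FlowStep
open Literature.MathematicalPhysics.QuantumFieldTheory.Balaban1983to89.T4CouplingMatching
open Literature.MathematicalPhysics.QuantumFieldTheory.Balaban1983to89.T4ContinuumCoupling
open Summit.QuantumFields.BalabanUV.Beta.RemainderExplicitHistoryDiagonalMonotone
open Summit.QuantumFields.BalabanUV.Beta.RemainderExplicitHistoryDiagonalTwoRun
open Summit.QuantumFields.BalabanUV.Beta.RemainderExplicitHistoryDiagonalSource

variable {β : HBeta} {b γ W : ℝ} {ρ : ℕ → ℝ}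

/-! ## §1 For a pinned FAMILY of runs: the cutoff discrepancy of the continuum coupling against the extra-history source -/

/-- **FAMILY FORM OF THE UPPER HALF.**  A family `K ↦ g K` of runs of the order-0 profile family in ]0,γ] pinned at one `g_IR` (`b > 0`,
`ρ ≥ 0`, `Σ_{a<N} ρ_a ≤ W`, `Wγ < b`): at every infrared distance `m` and for every pair of cutoffs `m`, `n + m`,
`0 ≤ invSq g m n − invSq g m 0 ≤ (Σ_{j<m} Σ_{i<n} ρ(j+n−i)·(g^{(n+m)}_{j+n} − g^{(n+m)}_i)) ∕ (1 − Wγ∕b)` — the recursion variable `m` scales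
above the pin moves, between the cutoffs `m` and `n + m`, by at most the longer run's extra-history source.
[cite: Balaban1987RG1, (0.20) p.256, (0.31) and Thm 2 p.259] -/
theorem invSq_sub_le_src
    (hβ : ∀ (k : ℕ) (p : Fin (k + 1) → ℝ),
      β k p = b + ∑ i : Fin (k + 1), ρ (k - i) * min (p (Fin.last k)) (|p (Fin.last k) - p i|))
    (hb : 0 < b) (hγ : 0 < γ) (hρ0 : ∀ a, 0 ≤ ρ a) (hρW : ∀ n, ∑ a ∈ range n, ρ a ≤ W) (hsmall : W * γ < b)
    {g : ℕ → ℕ → ℝ} {gIR : ℝ} (hrun : ∀ K, RGEqH K β (g K)) (hbox : ∀ K i, i ≤ K → 0 < g K i ∧ g K i ≤ γ)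
    (hpin : ∀ K, g K K = gIR) (m n : ℕ) :
    0 ≤ invSq g m n - invSq g m 0 ∧ invSq g m n - invSq g m 0
      ≤ (∑ j ∈ range m, ∑ i ∈ range n, ρ (j + n - i) * (g (n + m) (j + n) - g (n + m) i)) / (1 - W * γ / b) := by
  have hB : RGEqH (m + n) β (g (n + m)) := by rw [Nat.add_comm]; exact hrun (n + m)
  have hBbox : ∀ k, k ≤ m + n → 0 < g (n + m) k ∧ g (n + m) k ≤ γ := fun k hk => hbox _ k (by omega)
  have hpin' : g m m = g (n + m) (m + n) := by rw [hpin, Nat.add_comm m n, hpin]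
  have h := shift_disc_le_src hβ hb hγ hρ0 hρW hsmall (hrun m) hB (hbox m) hBbox hpin' 0 (Nat.zero_le m)
  simp only [Nat.zero_add, invSq] at h ⊢
  exact h

/-- **FAMILY FORM, IN THE LIMIT.**  Same family; if `S` bounds the extra-history sources `Σ_{j<m} Σ_{i<n} ρ(j+n−i)·(g^{(n+m)}_{j+n} − g^{(n+m)}_i)`
of infrared distance `m` for every cutoff `n`, THEN THE CUTOFF DISCREPANCY OF THE CONTINUUM COUPLING obeys
`0 ≤ astar g m − invSq g m 0 ≤ S ∕ (1 − Wγ∕b)` (`astar g m` = the continuum recursion variable `m` scales above the pin — it exists by the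
ninth file's `continuum_monotone`; `invSq g m 0 = 1∕(g^{(m)}_0)²` = the ultraviolet end of the run with exactly `m` steps).
[cite: Balaban1987RG1, (0.20) p.256, (0.31) and Thm 2 p.259] -/
theorem astar_sub_invSq_le
    (hβ : ∀ (k : ℕ) (p : Fin (k + 1) → ℝ),
      β k p = b + ∑ i : Fin (k + 1), ρ (k - i) * min (p (Fin.last k)) (|p (Fin.last k) - p i|))
    (hb : 0 < b) (hγ : 0 < γ) (hρ0 : ∀ a, 0 ≤ ρ a) (hρW : ∀ n, ∑ a ∈ range n, ρ a ≤ W) (hsmall : W * γ < b)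
    {g : ℕ → ℕ → ℝ} {gIR : ℝ} (hrun : ∀ K, RGEqH K β (g K)) (hbox : ∀ K i, i ≤ K → 0 < g K i ∧ g K i ≤ γ)
    (hpin : ∀ K, g K K = gIR) (m : ℕ) {S : ℝ}
    (hS : ∀ n, ∑ j ∈ range m, ∑ i ∈ range n, ρ (j + n - i) * (g (n + m) (j + n) - g (n + m) i) ≤ S) :
    0 ≤ astar g m - invSq g m 0 ∧ astar g m - invSq g m 0 ≤ S / (1 - W * γ / b) := by
  have ht : Tendsto (invSq g m) atTop (𝓝 (astar g m)) := (continuum_monotone hβ hb hγ hρ0 hρW hrun hbox hpin).1 m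
  have hq : 0 < 1 - W * γ / b := by
    have : W * γ / b < 1 := by rw [div_lt_one hb]; exact hsmall
    linarith
  have hup : ∀ n, invSq g m n ≤ invSq g m 0 + S / (1 - W * γ / b) := fun n => by
    have h := (invSq_sub_le_src hβ hb hγ hρ0 hρW hsmall hrun hbox hpin m n).2
    have h' := div_le_div_of_nonneg_right (hS n) hq.le
    linarith
  have hlo' : ∀ n, invSq g m 0 ≤ invSq g m n := fun n => by
    have := (invSq_sub_le_src hβ hb hγ hρ0 hρW hsmall hrun hbox hpin m n).1
    linarith
  have h1 : astar g m ≤ invSq g m 0 + S / (1 - W * γ / b) := le_of_tendsto' ht hup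
  have h2 : invSq g m 0 ≤ astar g m := ge_of_tendsto' ht hlo'
  constructor <;> linarith

/-- **FAMILY FORM OF THE LOWER HALF** (no smallness).  Same family (`b > 0`, `ρ ≥ 0`, `Σ_{a<N} ρ_a ≤ W`); if `C` bounds the cutoff
discrepancies `astar g m′ − invSq g m′ 0` at all infrared distances `m′ ≤ m`, THEN every extra-history source of infrared distance `m` obeys
`Σ_{j<m} Σ_{i<n} ρ(j+n−i)·(g^{(n+m)}_{j+n} − g^{(n+m)}_i) ≤ (1 + Wγ∕b)·C` (the matched discrepancies at `j ≤ m` are `≤ astar g (m−j) −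
invSq g (m−j) 0 ≤ C` by the ninth file's monotonicity in the cutoff). [cite: Balaban1987RG1, (0.20) p.256, (0.31) and Thm 2 p.259] -/
theorem src_le_of_astar_sub_invSq_le
    (hβ : ∀ (k : ℕ) (p : Fin (k + 1) → ℝ),
      β k p = b + ∑ i : Fin (k + 1), ρ (k - i) * min (p (Fin.last k)) (|p (Fin.last k) - p i|))
    (hb : 0 < b) (hγ : 0 < γ) (hρ0 : ∀ a, 0 ≤ ρ a) (hρW : ∀ n, ∑ a ∈ range n, ρ a ≤ W)
    {g : ℕ → ℕ → ℝ} {gIR : ℝ} (hrun : ∀ K, RGEqH K β (g K)) (hbox : ∀ K i, i ≤ K → 0 < g K i ∧ g K i ≤ γ)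
    (hpin : ∀ K, g K K = gIR) {m : ℕ} {C : ℝ} (hC : ∀ m', m' ≤ m → astar g m' - invSq g m' 0 ≤ C) (n : ℕ) :
    ∑ j ∈ range m, ∑ i ∈ range n, ρ (j + n - i) * (g (n + m) (j + n) - g (n + m) i) ≤ (1 + W * γ / b) * C := by
  have hB : RGEqH (m + n) β (g (n + m)) := by rw [Nat.add_comm]; exact hrun (n + m)
  have hBbox : ∀ k, k ≤ m + n → 0 < g (n + m) k ∧ g (n + m) k ≤ γ := fun k hk => hbox _ k (by omega)
  have hpin' : g m m = g (n + m) (m + n) := by rw [hpin, Nat.add_comm m n, hpin]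
  have hmono := invSq_mono hβ hb hρ0 hrun hbox hpin
  have ht := (continuum_monotone hβ hb hγ hρ0 hρW hrun hbox hpin).1
  have hd : ∀ j, j ≤ m → 1 / (g (n + m) (j + n)) ^ 2 - 1 / (g m j) ^ 2 ≤ C := by
    intro j hj
    have e1 : invSq g (m - j) (j + n) = 1 / (g (n + m) (j + n)) ^ 2 := by
      rw [invSq_def, show j + n + (m - j) = n + m by omega]
    have e2 : invSq g (m - j) j = 1 / (g m j) ^ 2 := by
      rw [invSq_def, show j + (m - j) = m by omega]
    have h1 : invSq g (m - j) (j + n) ≤ astar g (m - j) := (hmono (m - j)).ge_of_tendsto (ht (m - j)) (j + n)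
    have h2 : invSq g (m - j) 0 ≤ invSq g (m - j) j := hmono (m - j) (Nat.zero_le j)
    have h3 := hC (m - j) (Nat.sub_le m j)
    rw [← e1, ← e2]
    linarith
  have h := src_le_shift_disc hβ hb hγ hρ0 hρW (hrun m) hB (hbox m) hBbox hpin' hd
  have h0 : 1 / (g (n + m) n) ^ 2 - 1 / (g m 0) ^ 2 ≤ C := by simpa using hd 0 (Nat.zero_le m)
  have hW : 0 ≤ W := by simpa using hρW 0
  have hC0 : 0 ≤ C := by
    have := hC 0 (Nat.zero_le m)
    have h00 : invSq g 0 0 ≤ astar g 0 := (hmono 0).ge_of_tendsto (ht 0) 0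
    linarith
  nlinarith [mul_nonneg (div_nonneg (mul_nonneg hW hγ.le) hb.le) hC0]

/-! ## §2 ENDs: the two-sided law for the cutoff discrepancy of the continuum coupling, and the moment corollaries -/

/-- `min(a,m)² ≤ √a·(m√m)`, `min(a,m)² ≤ a·m`, `min(a,m)² ≤ a²` — the three moment conversions. [folklore] -/
theorem min_sq_le (a m : ℕ) :
    (min (a : ℝ) m) ^ 2 ≤ Real.sqrt a * ((m : ℝ) * Real.sqrt m) ∧ (min (a : ℝ) m) ^ 2 ≤ (a : ℝ) * m
      ∧ (min (a : ℝ) m) ^ 2 ≤ (a : ℝ) ^ 2 := by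
  have ha : (0 : ℝ) ≤ a := Nat.cast_nonneg a
  have hm : (0 : ℝ) ≤ m := Nat.cast_nonneg m
  have hsa : Real.sqrt a * Real.sqrt a = a := Real.mul_self_sqrt ha
  have hsm : Real.sqrt m * Real.sqrt m = m := Real.mul_self_sqrt hm
  have hsa0 := Real.sqrt_nonneg (a : ℝ)
  have hsm0 := Real.sqrt_nonneg (m : ℝ)
  rcases le_total (a : ℝ) m with h | h
  · rw [min_eq_left h]
    have hs : Real.sqrt a ≤ Real.sqrt m := Real.sqrt_le_sqrt h
    refine ⟨?_, by nlinarith, le_rfl⟩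
    calc (a : ℝ) ^ 2 = Real.sqrt a * (a * Real.sqrt a) := by
          rw [show Real.sqrt a * (a * Real.sqrt a) = Real.sqrt a * Real.sqrt a * (a : ℝ) by ring, hsa, sq]
      _ ≤ Real.sqrt a * ((m : ℝ) * Real.sqrt m) :=
          mul_le_mul_of_nonneg_left (mul_le_mul h hs hsa0 hm) hsa0
  · rw [min_eq_right h]
    have hs : Real.sqrt m ≤ Real.sqrt a := Real.sqrt_le_sqrt h
    refine ⟨?_, by nlinarith, by nlinarith⟩
    calc (m : ℝ) ^ 2 = Real.sqrt m * ((m : ℝ) * Real.sqrt m) := by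
          rw [show Real.sqrt m * ((m : ℝ) * Real.sqrt m) = Real.sqrt m * Real.sqrt m * (m : ℝ) by ring, hsm, sq]
      _ ≤ Real.sqrt a * ((m : ℝ) * Real.sqrt m) := mul_le_mul_of_nonneg_right hs (by positivity)

/-- **END — THE CUTOFF DISCREPANCY FROM ABOVE.**  A family `K ↦ g K` of runs of the order-0 profile family
`β_{k+1} = b + Σ_{i≤k} ρ(k−i)·min(g_k, |g_k − g_i|)` in ]0,γ] pinned at one `g_IR` (`b > 0`, `ρ ≥ 0`, `Σ_{a<N} ρ_a ≤ W`, `Wγ < b`).  THEN at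
every infrared distance `m ≥ 1`, if `Ψ` bounds the partial sums `Σ_{a<N} ρ(a)·min(a,m)²`:
`0 ≤ astar g m − invSq g m 0 ≤ (8κ ∕ ((1 − Wγ∕b)·m·√(bm)))·Ψ`, `κ = (b + Wγ)∕b` — the continuum recursion variable `m` scales above the pin
exceeds the ultraviolet end of the run with exactly `m` steps by at most `O(m^{−3∕2}·Σ_a ρ(a)·min(a,m)²)`.
[cite: Balaban1987RG1, (0.20) p.256, (0.31) and Thm 2 p.259] -/
theorem astar_sub_invSq_le_minSq
    (hβ : ∀ (k : ℕ) (p : Fin (k + 1) → ℝ),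
      β k p = b + ∑ i : Fin (k + 1), ρ (k - i) * min (p (Fin.last k)) (|p (Fin.last k) - p i|))
    (hb : 0 < b) (hγ : 0 < γ) (hρ0 : ∀ a, 0 ≤ ρ a) (hρW : ∀ n, ∑ a ∈ range n, ρ a ≤ W) (hsmall : W * γ < b)
    {g : ℕ → ℕ → ℝ} {gIR : ℝ} (hrun : ∀ K, RGEqH K β (g K)) (hbox : ∀ K i, i ≤ K → 0 < g K i ∧ g K i ≤ γ)
    (hpin : ∀ K, g K K = gIR) {m : ℕ} (hm : 1 ≤ m) {Ψ : ℝ} (hΨ : ∀ N, ∑ a ∈ range N, ρ a * (min (a : ℝ) m) ^ 2 ≤ Ψ) :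
    0 ≤ astar g m - invSq g m 0 ∧ astar g m - invSq g m 0
      ≤ 8 * ((b + W * γ) / b) / ((1 - W * γ / b) * ((m : ℝ) * Real.sqrt (b * m))) * Ψ := by
  have hW : 0 ≤ W := by simpa using hρW 0
  have hmpos : (0 : ℝ) < m := by exact_mod_cast hm
  have hc : 0 ≤ 8 * ((b + W * γ) / b) / ((m : ℝ) * Real.sqrt (b * m)) := by positivity
  have hS : ∀ n, ∑ j ∈ range m, ∑ i ∈ range n, ρ (j + n - i) * (g (n + m) (j + n) - g (n + m) i)
      ≤ 8 * ((b + W * γ) / b) / ((m : ℝ) * Real.sqrt (b * m)) * Ψ := by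
    intro n
    have hB : RGEqH (m + n) β (g (n + m)) := by rw [Nat.add_comm]; exact hrun (n + m)
    have hBbox : ∀ k, k ≤ m + n → 0 < g (n + m) k ∧ g (n + m) k ≤ γ := fun k hk => hbox _ k (by omega)
    exact (src_le hβ hb hγ hρ0 hρW hm hB hBbox).trans (mul_le_mul_of_nonneg_left (hΨ _) hc)
  have h := astar_sub_invSq_le hβ hb hγ hρ0 hρW hsmall hrun hbox hpin m hS
  refine ⟨h.1, h.2.trans (le_of_eq ?_)⟩
  have hq : 0 < 1 - W * γ / b := by
    have : W * γ / b < 1 := by rw [div_lt_one hb]; exact hsmall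
    linarith
  field_simp

/-- **END — THE THREE MOMENT COROLLARIES** (same family, `m ≥ 1`, `κ = (b+Wγ)∕b`, `q = 1 − Wγ∕b`):
(i) a HALF MOMENT `Σ_{a<N} ρ(a)√a ≤ M` gives `astar g m − invSq g m 0 ≤ 8κM∕(q√b)` UNIFORMLY IN `m` (the answer to the m-uniformity question of
the ninth file's `hasSum_disc`; NOT the first moment); (ii) a FIRST MOMENT `Σ_{a<N} ρ(a)·a ≤ M₁` gives DECAY `≤ 8κM₁∕(q√b·√m)`; (iii) a SECOND
MOMENT `Σ_{a<N} ρ(a)·a² ≤ M₂` gives `≤ 8κM₂∕(q·m√(bm))`. [cite: Balaban1987RG1, (0.20) p.256, (0.31) and Thm 2 p.259] -/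
theorem astar_sub_invSq_le_of_moments
    (hβ : ∀ (k : ℕ) (p : Fin (k + 1) → ℝ),
      β k p = b + ∑ i : Fin (k + 1), ρ (k - i) * min (p (Fin.last k)) (|p (Fin.last k) - p i|))
    (hb : 0 < b) (hγ : 0 < γ) (hρ0 : ∀ a, 0 ≤ ρ a) (hρW : ∀ n, ∑ a ∈ range n, ρ a ≤ W) (hsmall : W * γ < b)
    {g : ℕ → ℕ → ℝ} {gIR : ℝ} (hrun : ∀ K, RGEqH K β (g K)) (hbox : ∀ K i, i ≤ K → 0 < g K i ∧ g K i ≤ γ)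
    (hpin : ∀ K, g K K = gIR) {m : ℕ} (hm : 1 ≤ m) :
    (∀ M : ℝ, (∀ N, ∑ a ∈ range N, ρ a * Real.sqrt a ≤ M) →
        astar g m - invSq g m 0 ≤ 8 * ((b + W * γ) / b) / ((1 - W * γ / b) * Real.sqrt b) * M)
      ∧ (∀ M₁ : ℝ, (∀ N, ∑ a ∈ range N, ρ a * a ≤ M₁) →
        astar g m - invSq g m 0 ≤ 8 * ((b + W * γ) / b) / ((1 - W * γ / b) * Real.sqrt b * Real.sqrt m) * M₁)
      ∧ (∀ M₂ : ℝ, (∀ N, ∑ a ∈ range N, ρ a * (a : ℝ) ^ 2 ≤ M₂) →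
        astar g m - invSq g m 0 ≤ 8 * ((b + W * γ) / b) / ((1 - W * γ / b) * ((m : ℝ) * Real.sqrt (b * m))) * M₂) := by
  have hW : 0 ≤ W := by simpa using hρW 0
  have hmpos : (0 : ℝ) < m := by exact_mod_cast hm
  have hq : 0 < 1 - W * γ / b := by
    have : W * γ / b < 1 := by rw [div_lt_one hb]; exact hsmall
    linarith
  have hsbm : Real.sqrt (b * m) = Real.sqrt b * Real.sqrt m := Real.sqrt_mul hb.le _
  have hsb : 0 < Real.sqrt b := Real.sqrt_pos.2 hb
  have hsm : 0 < Real.sqrt (m : ℝ) := Real.sqrt_pos.2 hmpos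
  have main := fun (Ψ : ℝ) (hΨ : ∀ N, ∑ a ∈ range N, ρ a * (min (a : ℝ) m) ^ 2 ≤ Ψ) =>
    (astar_sub_invSq_le_minSq hβ hb hγ hρ0 hρW hsmall hrun hbox hpin hm hΨ).2
  refine ⟨fun M hM => ?_, fun M₁ hM₁ => ?_, fun M₂ hM₂ => ?_⟩
  · -- half moment: `min(a,m)² ≤ √a·m√m`
    have hΨ : ∀ N, ∑ a ∈ range N, ρ a * (min (a : ℝ) m) ^ 2 ≤ M * ((m : ℝ) * Real.sqrt m) := fun N => by
      calc ∑ a ∈ range N, ρ a * (min (a : ℝ) m) ^ 2 ≤ ∑ a ∈ range N, ρ a * Real.sqrt a * ((m : ℝ) * Real.sqrt m) := by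
            refine Finset.sum_le_sum fun a _ => ?_
            rw [mul_assoc]
            exact mul_le_mul_of_nonneg_left (min_sq_le a m).1 (hρ0 a)
        _ = (∑ a ∈ range N, ρ a * Real.sqrt a) * ((m : ℝ) * Real.sqrt m) := by rw [Finset.sum_mul]
        _ ≤ M * ((m : ℝ) * Real.sqrt m) := mul_le_mul_of_nonneg_right (hM N) (by positivity)
    refine (main _ hΨ).trans (le_of_eq ?_)
    rw [hsbm]
    field_simp
  · -- first moment: `min(a,m)² ≤ a·m`
    have hΨ : ∀ N, ∑ a ∈ range N, ρ a * (min (a : ℝ) m) ^ 2 ≤ M₁ * m := fun N => by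
      calc ∑ a ∈ range N, ρ a * (min (a : ℝ) m) ^ 2 ≤ ∑ a ∈ range N, ρ a * a * m := by
            refine Finset.sum_le_sum fun a _ => ?_
            rw [mul_assoc]
            exact mul_le_mul_of_nonneg_left (min_sq_le a m).2.1 (hρ0 a)
        _ = (∑ a ∈ range N, ρ a * a) * m := by rw [Finset.sum_mul]
        _ ≤ M₁ * m := mul_le_mul_of_nonneg_right (hM₁ N) hmpos.le
    refine (main _ hΨ).trans (le_of_eq ?_)
    rw [hsbm]
    have hsm2 : Real.sqrt (m : ℝ) * Real.sqrt m = m := Real.mul_self_sqrt hmpos.le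
    field_simp
  · -- second moment: `min(a,m)² ≤ a²`
    have hΨ : ∀ N, ∑ a ∈ range N, ρ a * (min (a : ℝ) m) ^ 2 ≤ M₂ := fun N =>
      (Finset.sum_le_sum fun a _ => mul_le_mul_of_nonneg_left (min_sq_le a m).2.2 (hρ0 a)).trans (hM₂ N)
    exact main _ hΨ

/-- **END — THE CUTOFF DISCREPANCY FROM BELOW (necessity; no smallness).**  Same family (`b > 0`, `ρ ≥ 0`, `Σ_{a<N} ρ_a ≤ W`); with
`b₂ = 1∕g_IR² + (b + Wγ)` and `κ₂ = b₂∕b`: if `C` bounds `astar g m′ − invSq g m′ 0` for all `m′ ≤ m` (`m ≥ 1`), THEN for every `N`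
`(1 ∕ (8κ₂·m√(b₂m)))·Σ_{a<N} ρ(a)·min(a,m)² ≤ (1 + Wγ∕b)·C` — so `sup_m (astar g m − invSq g m 0) < ∞` FORCES
`Σ_a ρ(a)·min(a,m)² = O(m^{3∕2})`. [cite: Balaban1987RG1, (0.20) p.256, (0.31) and Thm 2 p.259] -/
theorem minSq_le_of_astar_sub_invSq_le
    (hβ : ∀ (k : ℕ) (p : Fin (k + 1) → ℝ),
      β k p = b + ∑ i : Fin (k + 1), ρ (k - i) * min (p (Fin.last k)) (|p (Fin.last k) - p i|))
    (hb : 0 < b) (hγ : 0 < γ) (hρ0 : ∀ a, 0 ≤ ρ a) (hρW : ∀ n, ∑ a ∈ range n, ρ a ≤ W)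
    {g : ℕ → ℕ → ℝ} {gIR : ℝ} (hrun : ∀ K, RGEqH K β (g K)) (hbox : ∀ K i, i ≤ K → 0 < g K i ∧ g K i ≤ γ)
    (hpin : ∀ K, g K K = gIR) {m : ℕ} (hm : 1 ≤ m) {C : ℝ} (hC : ∀ m', m' ≤ m → astar g m' - invSq g m' 0 ≤ C) (N : ℕ) :
    1 / (8 * ((1 / gIR ^ 2 + (b + W * γ)) / b * m * Real.sqrt ((1 / gIR ^ 2 + (b + W * γ)) * m)))
        * ∑ a ∈ range N, ρ a * (min (a : ℝ) m) ^ 2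
      ≤ (1 + W * γ / b) * C := by
  have hB : RGEqH (m + N) β (g (N + m)) := by rw [Nat.add_comm]; exact hrun (N + m)
  have hBbox : ∀ k, k ≤ m + N → 0 < g (N + m) k ∧ g (N + m) k ≤ γ := fun k hk => hbox _ k (by omega)
  have hpin' : g (N + m) (m + N) = gIR := by rw [Nat.add_comm m N, hpin]
  have h1 := le_src hβ hb hγ hρ0 hρW hm hB hBbox (Nat.le_succ N)
  rw [hpin'] at h1
  exact h1.trans (src_le_of_astar_sub_invSq_le hβ hb hγ hρ0 hρW hrun hbox hpin hC N)

/-- **END — THE m-UNIFORMITY CRITERION** (the ninth file's question «when is `sup_m (astar g m − 1∕(g^{(m)}_0)²)` finite?», answered for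
every pinned family of runs of the order-0 profile family under `Wγ < b`): the cutoff discrepancy of the continuum coupling is bounded
UNIFORMLY in the infrared distance `m` IFF `Σ_a ρ(a)·min(a,m)² = O(m^{3∕2})` (partial sums, uniformly).  By `min_sq_le` a bounded HALF
moment `Σ_a ρ(a)√a` suffices (a bounded FIRST moment even gives decay `O(m^{−1∕2})`), while e.g. `√m·Σ_{a ≥ m} ρ(a) → ∞` violates it.
[cite: Balaban1987RG1, (0.20) p.256, (0.31) and Thm 2 p.259] -/
theorem uniform_iff_minSq
    (hβ : ∀ (k : ℕ) (p : Fin (k + 1) → ℝ),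
      β k p = b + ∑ i : Fin (k + 1), ρ (k - i) * min (p (Fin.last k)) (|p (Fin.last k) - p i|))
    (hb : 0 < b) (hγ : 0 < γ) (hρ0 : ∀ a, 0 ≤ ρ a) (hρW : ∀ n, ∑ a ∈ range n, ρ a ≤ W) (hsmall : W * γ < b)
    {g : ℕ → ℕ → ℝ} {gIR : ℝ} (hrun : ∀ K, RGEqH K β (g K)) (hbox : ∀ K i, i ≤ K → 0 < g K i ∧ g K i ≤ γ)
    (hpin : ∀ K, g K K = gIR) :
    (∃ C : ℝ, ∀ m : ℕ, astar g m - invSq g m 0 ≤ C)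
      ↔ ∃ C' : ℝ, ∀ m : ℕ, 1 ≤ m → ∀ N, ∑ a ∈ range N, ρ a * (min (a : ℝ) m) ^ 2 ≤ C' * ((m : ℝ) * Real.sqrt m) := by
  have hW : 0 ≤ W := by simpa using hρW 0
  have hgIR : 0 < gIR := by rw [← hpin 0]; exact (hbox 0 0 le_rfl).1
  have hq : 0 < 1 - W * γ / b := by
    have : W * γ / b < 1 := by rw [div_lt_one hb]; exact hsmall
    linarith
  set b₂ : ℝ := 1 / gIR ^ 2 + (b + W * γ) with hb₂
  have hb₂pos : 0 < b₂ := by rw [hb₂]; positivity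
  constructor
  · rintro ⟨C, hC⟩
    -- necessity: `Σ ≤ 8κ₂ m√(b₂ m)·(1 + Wγ∕b)·C = [8κ₂√b₂(1+Wγ∕b)C]·m√m`
    refine ⟨8 * (b₂ / b) * Real.sqrt b₂ * ((1 + W * γ / b) * C), fun m hm N => ?_⟩
    have hmpos : (0 : ℝ) < m := Nat.cast_pos.mpr hm
    have h := minSq_le_of_astar_sub_invSq_le hβ hb hγ hρ0 hρW hrun hbox hpin hm (fun m' _ => hC m') N
    have hden : 0 < 8 * (b₂ / b * m * Real.sqrt (b₂ * m)) := by positivity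
    rw [← hb₂, one_div_mul_eq_div] at h
    rw [div_le_iff₀ hden] at h
    rw [Real.sqrt_mul hb₂pos.le] at h
    refine h.trans (le_of_eq ?_)
    ring
  · rintro ⟨C', hC'⟩
    have hC'0 : 0 ≤ C' := by
      have := hC' 1 le_rfl 0
      simpa using this
    refine ⟨8 * ((b + W * γ) / b) / ((1 - W * γ / b) * Real.sqrt b) * C', fun m => ?_⟩
    rcases Nat.eq_zero_or_pos m with h0 | hm
    · -- `m = 0`: the source is an empty sum
      subst h0
      have h := astar_sub_invSq_le hβ hb hγ hρ0 hρW hsmall hrun hbox hpin 0 (S := 0) (fun n => by simp)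
      rw [zero_div] at h
      exact h.2.trans (by positivity)
    · have hmpos : (0 : ℝ) < m := by exact_mod_cast hm
      have h := (astar_sub_invSq_le_minSq hβ hb hγ hρ0 hρW hsmall hrun hbox hpin hm (hC' m hm)).2
      refine h.trans (le_of_eq ?_)
      rw [Real.sqrt_mul hb.le]
      have hsb : 0 < Real.sqrt b := Real.sqrt_pos.2 hb
      have hsm : 0 < Real.sqrt (m : ℝ) := Real.sqrt_pos.2 hmpos
      field_simp

end Summit.QuantumFields.BalabanUV.Beta.RemainderExplicitHistoryDiagonalCriterion

end
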